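import Literature.NumberTheory.Automorphic.ArchTorusOrbitalFunctionCompact   -- ★ p838154 (V2)-Q: the fixed-quotient torus term `F_f(z) = t_T(T)⁻¹ • ∫ f(g·diag z·g⁻¹) dν`
import Mathlib.LinearAlgebra.Vandermonde
import Mathlib.MeasureTheory.Integral.Bochner.Set
import Mathlib.Analysis.Normed.Ring.Units
import HarnessLib

/-!
# The torus orbital function is continuous on the regular set — in `U(σ_w diag α)(ℂ)` of ANY signature (ROAD-Sd (V2)-glob, per place)

Topic `NumberTheory/Automorphic`; namespace `Literature.NumberTheory.Automorphic.UnitaryGroup`.  THEOREMS ONLY (no `def`, no instance, no notation,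
no axiom, no `sorry`).  Cell `pub/hodgecm-mathlib`, ENGINE T1 (crux H413 = `stmt-HodgeConjecture-24833`); floor-1 preparation, count-neutral, under books
rows #111 (S-d) ∕ #88 (ST-∞) (ROAD-Sd §2 (V2): the limit formula (L-cont)∕(L-jump) at floor 2 differentiates and takes one-sided limits of the torus orbital
function `z ↦ Φ(diag z, f)` ALONG THE REGULAR SET; ★ (V2)-Q `ArchTorusOrbitalFunctionCompact` gave continuity only at DEFINITE places, by compactness of
`G_w`; this file removes that restriction); author F0P3a-p06 (g9) (LEAD DESK WORD T7-32).

WHAT IS PROVED (`G_w = archLocal L N (diag α) w ⊆ GL_N(ℂ)`, `α_i ≠ 0`, torus points `diag z`, `z ∈ (S¹)^N`, regular = `z` injective).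
* §1 LINEAR ALGEBRA: `sum_vandermonde_inv_mul_conj_pow_apply` — for `x = g·diag z·g⁻¹`, `Σ_m (V(z)⁻¹)_{m i} (x^m)_{k k} = g_{k i} (g⁻¹)_{i k}` (the
  eigenprojector `g E_{ii} g⁻¹` is the Lagrange polynomial of `x`, written through the inverse Vandermonde matrix); for `g ∈ U(diag e)(ℂ)`,
  `(g⁻¹)_{i k} = e_i⁻¹ conj(g_{k i}) e_k`, hence **`normSq_apply_eq_of_mem_unitaryGroupOfForm_diagonal`: `|g_{k i}|²` is an explicit CONTINUOUS function of
  `(g·diag z·g⁻¹, z)` on the regular set** (`continuousOn_mul_sum_vandermonde_inv_mul_pow_apply`); `isOpen_setOf_injective` (the regular set is open).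
* §2 **`isCompact_setOf_exists_conj_circleDiagonal_mem` — JOINT PROPERNESS**: for compact `K ⊆ T_reg` and compact `C ⊆ G_w`,
  `{g ∈ G_w | ∃ z ∈ K, g·diag z·g⁻¹ ∈ C}` is compact (no compactness of `G_w`: entries of `g` and `g⁻¹` are bounded by §1, and `G_w ↪ M_N(ℂ)²` is a closed
  embedding); `hasCompactSupport_comp_conj_circleDiagonal`.
* §3 **`continuousOn_integral_comp_conj_circleDiagonal`**: for `f ∈ C_c(G_w, E)` and any measure `ν` finite on compacts,
  `z ↦ ∫ f(g·diag z·g⁻¹) dν(g)` is `ContinuousOn {z | Injective z}` (Mathlib `continuousOn_integral_of_compact_support` on a compact neighbourhood with the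
  uniform support of §2); `integrable_comp_conj_circleDiagonal`; and **`continuousOn_integral_descConj_circleDiagonal_of_hasCompactSupport`**: the ★ (V2)-Q
  fixed-quotient torus term `F_f(z) = ∫ descConj (diag z) T_w f d(dν∕dt_T)` — equal at regular `z` to the Weil-form orbital integral by ★
  `orbitalIntegral_circleDiagonal_eq_inv_smul` — is continuous on `T_reg`.  This is the (L-cont) input «`Φ(γ, f)` is continuous on `T_reg`» in any signature.
NOT HERE: `C^∞` on `T_reg` and the GLOBAL `∏_w` statement over `arch L⁺ L c N (diag α)` (sequel `ArchTorusOrbitalContinuity`).  HONEST LABEL: HC_CM is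
proved only modulo the printed citations until rung 0 closes; this file is analysis on one real group and pays nothing by itself.

## References
* [Rogawski1990] J. D. Rogawski, *Automorphic Representations of Unitary Groups in Three Variables*, Ann. of Math. Stud. 123 (1990), §3.1 p. 19 (regular
  elements), §8.3 p. 122 (the orbital integral as a smooth function on `T_reg`), §4.9 p. 54, §1.9 p. 8.
* [HornJohnson2013] R. A. Horn, C. R. Johnson, *Matrix Analysis*, 2nd ed. (2013), §0.9.11 (Vandermonde), Thm 1.3.9 (distinct eigenvalues ⇒ diagonalisable;
  the eigenprojectors are polynomials in the matrix).
* [DeitmarEchterhoff2014] A. Deitmar, S. Echterhoff, *Principles of Harmonic Analysis*, 2nd ed. (2014), Lemma 9.3.3 (orbital integrals of `C_c` functions).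
* [Shelstad1979] D. Shelstad, *Characters and inner forms of a quasi-split group over ℝ*, Compositio Math. 39 (1979), §4.
* [BrockerTomDieck1985] Th. Bröcker, T. tom Dieck, *Representations of Compact Lie Groups*, GTM 98 (1985), IV (3.1) (the diagonal torus, regular set).
-/

set_option autoImplicit false

noncomputable section

open MeasureTheory Measure NumberField NumberField.InfinitePlace Filter Topology
open Literature.MeasureTheory.Group
open scoped Matrix MatrixGroups ComplexConjugate

namespace Literature.NumberTheory.Automorphic.UnitaryGroup

/-! ## §1 The Vandermonde form of the eigenprojector and the entry bound -/

section Vandermonde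

variable {K : Type*} [Field K] {N : ℕ}

/-- `Σ_m (V⁻¹)_{m i} z_k^m = δ_{k i}` for the Vandermonde matrix `V = (z_k^m)` of an injective `z`. [cite: HornJohnson2013, §0.9.11] -/
theorem sum_vandermonde_inv_mul_pow {z : Fin N → K} (hz : Function.Injective z) (i k : Fin N) :
    ∑ m, (Matrix.vandermonde z)⁻¹ m i * z k ^ (m : ℕ) = if k = i then 1 else 0 := by
  have hdet : IsUnit (Matrix.vandermonde z).det :=
    isUnit_iff_ne_zero.mpr (Matrix.det_vandermonde_ne_zero_iff.mpr hz)
  have h := congrFun (congrFun (Matrix.mul_nonsing_inv (Matrix.vandermonde z) hdet) k) i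
  rw [Matrix.mul_apply, Matrix.one_apply] at h
  simpa only [Matrix.vandermonde_apply, mul_comm] using h

/-- **THE EIGENPROJECTOR IS A POLYNOMIAL IN THE CONJUGATE**: for `x = g·diag z·g⁻¹` with `z` injective,
`Σ_m (V⁻¹)_{m i} (x^m)_{k k} = g_{k i} (g⁻¹)_{i k}` (the `(k,k)` entry of `g E_{ii} g⁻¹ = L_i(x)`, `L_i` the Lagrange polynomial).
[cite: HornJohnson2013, §0.9.11; Thm 1.3.9] -/
theorem sum_vandermonde_inv_mul_conj_pow_apply {z : Fin N → K} (hz : Function.Injective z) (g : GL (Fin N) K) (i k : Fin N) :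
    ∑ m, (Matrix.vandermonde z)⁻¹ m i *
        (((g : Matrix (Fin N) (Fin N) K) * Matrix.diagonal z * ((g⁻¹ : GL (Fin N) K) : Matrix (Fin N) (Fin N) K)) ^ (m : ℕ)) k k =
      (g : Matrix (Fin N) (Fin N) K) k i * ((g⁻¹ : GL (Fin N) K) : Matrix (Fin N) (Fin N) K) i k := by
  have hconj : ∀ m : ℕ, ((g : Matrix (Fin N) (Fin N) K) * Matrix.diagonal z * ((g⁻¹ : GL (Fin N) K) : Matrix (Fin N) (Fin N) K)) ^ m =
      (g : Matrix (Fin N) (Fin N) K) * Matrix.diagonal (z ^ m) * ((g⁻¹ : GL (Fin N) K) : Matrix (Fin N) (Fin N) K) := by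
    intro m
    rw [Units.conj_pow, Matrix.diagonal_pow]
  have hterm : ∀ m : Fin N, (((g : Matrix (Fin N) (Fin N) K) * Matrix.diagonal z * ((g⁻¹ : GL (Fin N) K) : Matrix (Fin N) (Fin N) K)) ^ (m : ℕ)) k k =
      ∑ a, (g : Matrix (Fin N) (Fin N) K) k a * z a ^ (m : ℕ) * ((g⁻¹ : GL (Fin N) K) : Matrix (Fin N) (Fin N) K) a k := by
    intro m
    rw [hconj, Matrix.mul_apply]
    refine Finset.sum_congr rfl fun a _ => ?_
    rw [Matrix.mul_diagonal, Pi.pow_apply]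
  simp_rw [hterm, Finset.mul_sum]
  rw [Finset.sum_comm]
  have h : ∀ a : Fin N, ∑ m : Fin N, (Matrix.vandermonde z)⁻¹ m i *
      ((g : Matrix (Fin N) (Fin N) K) k a * z a ^ (m : ℕ) * ((g⁻¹ : GL (Fin N) K) : Matrix (Fin N) (Fin N) K) a k) =
      (g : Matrix (Fin N) (Fin N) K) k a * ((g⁻¹ : GL (Fin N) K) : Matrix (Fin N) (Fin N) K) a k * (if a = i then 1 else 0) := by
    intro a
    rw [← sum_vandermonde_inv_mul_pow hz i a, Finset.mul_sum]
    exact Finset.sum_congr rfl fun m _ => by ring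
  simp_rw [h, mul_ite, mul_one, mul_zero, Finset.sum_ite_eq', Finset.mem_univ, if_true]

/-- The inverse Vandermonde matrix depends continuously on an injective `z` (`det V ≠ 0`). [cite: HornJohnson2013, §0.9.11; §5.6] -/
theorem continuousOn_vandermonde_inv :
    ContinuousOn (fun z : Fin N → ℂ => (Matrix.vandermonde z)⁻¹) {z | Function.Injective z} := by
  intro z hz
  have hdet : (Matrix.vandermonde z).det ≠ 0 := Matrix.det_vandermonde_ne_zero_iff.mpr hz
  have hV : Continuous fun z : Fin N → ℂ => Matrix.vandermonde z := by
    refine continuous_matrix fun i j => ?_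
    simp only [Matrix.vandermonde_apply]
    exact (continuous_apply i).pow _
  have hinv : ContinuousAt Inv.inv (Matrix.vandermonde z) :=
    continuousAt_matrix_inv _ (by simpa using NormedRing.inverse_continuousAt (Units.mk0 _ hdet))
  exact (hinv.comp hV.continuousAt).continuousWithinAt

/-- The entry-bound function `(x, z) ↦ e_i e_k⁻¹ Σ_m (V(z)⁻¹)_{m i} (x^m)_{k k}` is continuous on `{z injective}`. [cite: HornJohnson2013, Thm 1.3.9; §0.9.11] -/
theorem continuousOn_mul_sum_vandermonde_inv_mul_pow_apply (e : Fin N → ℂ) (k i : Fin N) :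
    ContinuousOn (fun p : Matrix (Fin N) (Fin N) ℂ × (Fin N → ℂ) =>
      e i * (e k)⁻¹ * ∑ m, (Matrix.vandermonde p.2)⁻¹ m i * (p.1 ^ (m : ℕ)) k k) {p | Function.Injective p.2} := by
  refine continuousOn_const.mul (continuousOn_finsetSum _ fun m _ => ContinuousOn.mul ?_ ?_)
  · have h := (continuousOn_vandermonde_inv (N := N)).comp
      (continuous_snd : Continuous (Prod.snd : Matrix (Fin N) (Fin N) ℂ × (Fin N → ℂ) → Fin N → ℂ)).continuousOn (fun p hp => hp)
    exact (continuous_id.matrix_elem m i).comp_continuousOn h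
  · exact ((continuous_fst.pow m).matrix_elem k k).continuousOn

end Vandermonde

section Unitary

variable {N : ℕ}

/-- For `g ∈ U(diag e)(ℂ)` (`e_i ≠ 0`): `(g⁻¹)_{i k} = e_i⁻¹ · conj(g_{k i}) · e_k` (`g⁻¹ = D⁻¹ gᴴ D`). [cite: Rogawski1990, §1.9 p. 8] -/
theorem coe_inv_apply_of_mem_unitaryGroupOfForm_diagonal {e : Fin N → ℂ} (he : ∀ i, e i ≠ 0) {g : GL (Fin N) ℂ}
    (hg : g ∈ unitaryGroupOfForm (starRingEnd ℂ) (Matrix.diagonal e)) (i k : Fin N) :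
    ((g⁻¹ : GL (Fin N) ℂ) : Matrix (Fin N) (Fin N) ℂ) i k = (e i)⁻¹ * (conj ((g : Matrix (Fin N) (Fin N) ℂ) k i) * e k) := by
  have h : ((g : Matrix (Fin N) (Fin N) ℂ).map (starRingEnd ℂ))ᵀ * Matrix.diagonal e * (g : Matrix (Fin N) (Fin N) ℂ) =
      Matrix.diagonal e := hg
  have h2 : ((g : Matrix (Fin N) (Fin N) ℂ).map (starRingEnd ℂ))ᵀ * Matrix.diagonal e =
      Matrix.diagonal e * ((g⁻¹ : GL (Fin N) ℂ) : Matrix (Fin N) (Fin N) ℂ) := by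
    calc ((g : Matrix (Fin N) (Fin N) ℂ).map (starRingEnd ℂ))ᵀ * Matrix.diagonal e
        = ((g : Matrix (Fin N) (Fin N) ℂ).map (starRingEnd ℂ))ᵀ * Matrix.diagonal e * (g : Matrix (Fin N) (Fin N) ℂ) *
            ((g⁻¹ : GL (Fin N) ℂ) : Matrix (Fin N) (Fin N) ℂ) := by
          rw [Matrix.mul_assoc _ (g : Matrix (Fin N) (Fin N) ℂ), ← Units.val_mul, mul_inv_cancel, Units.val_one, Matrix.mul_one]
      _ = Matrix.diagonal e * ((g⁻¹ : GL (Fin N) ℂ) : Matrix (Fin N) (Fin N) ℂ) := by rw [h]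
  have h3 := congrFun (congrFun h2 i) k
  rw [Matrix.mul_diagonal, Matrix.diagonal_mul, Matrix.transpose_apply, Matrix.map_apply] at h3
  rw [h3, ← mul_assoc, inv_mul_cancel₀ (he i), one_mul]

/-- **`|g_{k i}|²` IS A CONTINUOUS FUNCTION OF `(g·diag z·g⁻¹, z)`**: for `g ∈ U(diag e)(ℂ)` and `z` injective,
`|g_{k i}|² = e_i e_k⁻¹ Σ_m (V(z)⁻¹)_{m i} ((g·diag z·g⁻¹)^m)_{k k}`. [cite: HornJohnson2013, Thm 1.3.9] [cite: Rogawski1990, §3.1 p. 19] -/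
theorem normSq_apply_eq_of_mem_unitaryGroupOfForm_diagonal {e : Fin N → ℂ} (he : ∀ i, e i ≠ 0) {g : GL (Fin N) ℂ}
    (hg : g ∈ unitaryGroupOfForm (starRingEnd ℂ) (Matrix.diagonal e)) {z : Fin N → ℂ} (hz : Function.Injective z) (i k : Fin N) :
    (Complex.normSq ((g : Matrix (Fin N) (Fin N) ℂ) k i) : ℂ) =
      e i * (e k)⁻¹ * ∑ m, (Matrix.vandermonde z)⁻¹ m i *
        (((g : Matrix (Fin N) (Fin N) ℂ) * Matrix.diagonal z * ((g⁻¹ : GL (Fin N) ℂ) : Matrix (Fin N) (Fin N) ℂ)) ^ (m : ℕ)) k k := by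
  rw [sum_vandermonde_inv_mul_conj_pow_apply hz, coe_inv_apply_of_mem_unitaryGroupOfForm_diagonal he hg, Complex.normSq_eq_conj_mul_self,
    show e i * (e k)⁻¹ * ((g : Matrix (Fin N) (Fin N) ℂ) k i * ((e i)⁻¹ * (conj ((g : Matrix (Fin N) (Fin N) ℂ) k i) * e k))) =
      (e i * (e i)⁻¹) * (e k * (e k)⁻¹) * (conj ((g : Matrix (Fin N) (Fin N) ℂ) k i) * (g : Matrix (Fin N) (Fin N) ℂ) k i) by ring,
    mul_inv_cancel₀ (he i), mul_inv_cancel₀ (he k), one_mul, one_mul]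

/-- The entry bound: `‖g_{k i}‖² ≤ Σ_{k′ i′} ‖e_{i′} e_{k′}⁻¹ Σ_m (V⁻¹)_{m i′} (x^m)_{k′ k′}‖` with `x = g·diag z·g⁻¹`. [cite: HornJohnson2013, Thm 1.3.9] -/
theorem norm_apply_sq_le_of_mem_unitaryGroupOfForm_diagonal {e : Fin N → ℂ} (he : ∀ i, e i ≠ 0) {g : GL (Fin N) ℂ}
    (hg : g ∈ unitaryGroupOfForm (starRingEnd ℂ) (Matrix.diagonal e)) {z : Fin N → ℂ} (hz : Function.Injective z) (k i : Fin N) :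
    ‖(g : Matrix (Fin N) (Fin N) ℂ) k i‖ ^ 2 ≤
      ∑ k', ∑ i', ‖e i' * (e k')⁻¹ * ∑ m, (Matrix.vandermonde z)⁻¹ m i' *
        (((g : Matrix (Fin N) (Fin N) ℂ) * Matrix.diagonal z * ((g⁻¹ : GL (Fin N) ℂ) : Matrix (Fin N) (Fin N) ℂ)) ^ (m : ℕ)) k' k'‖ := by
  have h1 : ‖(g : Matrix (Fin N) (Fin N) ℂ) k i‖ ^ 2 = ‖e i * (e k)⁻¹ * ∑ m, (Matrix.vandermonde z)⁻¹ m i *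
      (((g : Matrix (Fin N) (Fin N) ℂ) * Matrix.diagonal z * ((g⁻¹ : GL (Fin N) ℂ) : Matrix (Fin N) (Fin N) ℂ)) ^ (m : ℕ)) k k‖ := by
    rw [← normSq_apply_eq_of_mem_unitaryGroupOfForm_diagonal he hg hz i k, Complex.norm_real, Real.norm_of_nonneg (Complex.normSq_nonneg _),
      Complex.normSq_eq_norm_sq]
  rw [h1]
  refine le_trans ?_ (Finset.single_le_sum (f := fun k' => ∑ i', ‖e i' * (e k')⁻¹ * ∑ m, (Matrix.vandermonde z)⁻¹ m i' *
        (((g : Matrix (Fin N) (Fin N) ℂ) * Matrix.diagonal z * ((g⁻¹ : GL (Fin N) ℂ) : Matrix (Fin N) (Fin N) ℂ)) ^ (m : ℕ)) k' k'‖)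
    (fun k' _ => Finset.sum_nonneg fun i' _ => norm_nonneg _) (Finset.mem_univ k))
  exact Finset.single_le_sum (f := fun i' => ‖e i' * (e k)⁻¹ * ∑ m, (Matrix.vandermonde z)⁻¹ m i' *
        (((g : Matrix (Fin N) (Fin N) ℂ) * Matrix.diagonal z * ((g⁻¹ : GL (Fin N) ℂ) : Matrix (Fin N) (Fin N) ℂ)) ^ (m : ℕ)) k k‖)
    (fun i' _ => norm_nonneg _) (Finset.mem_univ i)

/-- … and `‖(g⁻¹)_{i k}‖ = ‖e_i‖⁻¹ ‖g_{k i}‖ ‖e_k‖`. [cite: Rogawski1990, §1.9 p. 8] -/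
theorem norm_coe_inv_apply_of_mem_unitaryGroupOfForm_diagonal {e : Fin N → ℂ} (he : ∀ i, e i ≠ 0) {g : GL (Fin N) ℂ}
    (hg : g ∈ unitaryGroupOfForm (starRingEnd ℂ) (Matrix.diagonal e)) (i k : Fin N) :
    ‖((g⁻¹ : GL (Fin N) ℂ) : Matrix (Fin N) (Fin N) ℂ) i k‖ = ‖e i‖⁻¹ * ‖(g : Matrix (Fin N) (Fin N) ℂ) k i‖ * ‖e k‖ := by
  rw [coe_inv_apply_of_mem_unitaryGroupOfForm_diagonal he hg, norm_mul, norm_mul, norm_inv, Complex.norm_conj, mul_assoc]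

/-- The set of injective `z : ι → X` (finite `ι`, Hausdorff `X`) is open — the REGULAR SET of the torus `(S¹)^N` is open. [cite: Rogawski1990, §3.1 p. 19]
[cite: BrockerTomDieck1985, IV (3.1) (p0160)] -/
theorem isOpen_setOf_injective {ι X : Type*} [Finite ι] [TopologicalSpace X] [T2Space X] :
    IsOpen {z : ι → X | Function.Injective z} := by
  have h : {z : ι → X | Function.Injective z} = ⋂ i : ι, ⋂ j : ι, {z | i ≠ j → z i ≠ z j} := by
    ext z
    simp only [Set.mem_setOf_eq, Set.mem_iInter]
    exact ⟨fun hz i j hij h => hij (hz h), fun h i j hzij => by_contra fun hij => h i j hij hzij⟩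
  rw [h]
  refine isOpen_iInter_of_finite fun i => isOpen_iInter_of_finite fun j => ?_
  by_cases hij : i = j
  · have : {z : ι → X | i ≠ j → z i ≠ z j} = Set.univ := Set.eq_univ_of_forall fun z h => absurd hij h
    rw [this]; exact isOpen_univ
  · have : {z : ι → X | i ≠ j → z i ≠ z j} = {z | z i ≠ z j} := Set.ext fun z => ⟨fun h => h hij, fun h _ => h⟩
    rw [this]; exact isOpen_ne_fun (continuous_apply i) (continuous_apply j)

end Unitary
/-! ## §2 Joint properness of `(g, z) ↦ g·diag z·g⁻¹` over the regular set, in `G_w = U(σ_w diag α)(ℂ)` of ANY signature -/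

section Proper

variable (L : Type) [Field L] (N : ℕ) (α : Fin N → L) (w : {w : InfinitePlace L // IsComplex w})

/-- `σ_w(diag α) = diag(σ_w α)`. [folklore] -/
private theorem map_embedding_diagonal :
    (Matrix.diagonal α).map w.1.embedding = Matrix.diagonal fun i => w.1.embedding (α i) :=
  Matrix.diagonal_map (map_zero _)

/-- Elements of `G_w = archLocal L N (diag α) w` lie in `U(diag(σ_w α))(ℂ)`. [folklore] -/
private theorem coe_mem_unitaryGroupOfForm_diagonal (g : archLocal L N (Matrix.diagonal α) w) :
    (g : GL (Fin N) ℂ) ∈ unitaryGroupOfForm (starRingEnd ℂ) (Matrix.diagonal fun i => w.1.embedding (α i)) := by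
  rw [← map_embedding_diagonal]; exact g.2

/-- **JOINT PROPERNESS OF THE CONJUGATION MAP OVER THE REGULAR SET** (the content of «`Φ(γ, f)` is smooth on `T_reg`», Harish-Chandra): for
`diag α` non-degenerate, `K ⊆ T_reg` compact and `C ⊆ G_w` compact, the set of `g ∈ G_w` conjugating SOME `diag z`, `z ∈ K`, into `C` is COMPACT —
in `G_w` of ANY signature (no compactness of `G_w`).  Proof: it is the first projection of the closed set `{(g, z) | z ∈ K, g·diag z·g⁻¹ ∈ C}`, whose
`g`-entries and `g⁻¹`-entries are bounded by §1 (`|g_{ki}|²` is a continuous function of `(g·diag z·g⁻¹, z)` on the regular set), inside the closed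
subgroup `G_w ⊆ GL_N(ℂ) ↪ M_N(ℂ) × M_N(ℂ)`. [cite: Rogawski1990, §8.3 p. 122; §3.1 p. 19] [cite: DeitmarEchterhoff2014, Lemma 9.3.3] -/
theorem isCompact_setOf_exists_conj_circleDiagonal_mem (hα : ∀ i, α i ≠ 0) {K : Set (Fin N → Circle)} (hK : IsCompact K)
    (hKreg : K ⊆ {z | Function.Injective z}) {C : Set (archLocal L N (Matrix.diagonal α) w)} (hC : IsCompact C) :
    IsCompact {g : archLocal L N (Matrix.diagonal α) w | ∃ z ∈ K,
      g * ⟨circleDiagonal N z, circleDiagonal_mem_archLocal_diagonal L N α w z⟩ * g⁻¹ ∈ C} := by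
  have he : ∀ i, w.1.embedding (α i) ≠ 0 := fun i => (map_ne_zero _).mpr (hα i)
  -- the pair set `M = {(g, z) | z ∈ K, g·diag z·g⁻¹ ∈ C}`
  obtain ⟨M, hM⟩ : ∃ M : Set (archLocal L N (Matrix.diagonal α) w × (Fin N → Circle)),
      M = {p | p.2 ∈ K ∧ p.1 * ⟨circleDiagonal N p.2, circleDiagonal_mem_archLocal_diagonal L N α w p.2⟩ * p.1⁻¹ ∈ C} := ⟨_, rfl⟩
  have ht : Continuous fun p : archLocal L N (Matrix.diagonal α) w × (Fin N → Circle) =>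
      (⟨circleDiagonal N p.2, circleDiagonal_mem_archLocal_diagonal L N α w p.2⟩ : archLocal L N (Matrix.diagonal α) w) :=
    ((continuous_circleDiagonal N).comp continuous_snd).subtype_mk _
  have hconj : Continuous fun p : archLocal L N (Matrix.diagonal α) w × (Fin N → Circle) =>
      p.1 * ⟨circleDiagonal N p.2, circleDiagonal_mem_archLocal_diagonal L N α w p.2⟩ * p.1⁻¹ :=
    (continuous_fst.mul ht).mul continuous_fst.inv
  have hMclosed : IsClosed M := by
    rw [hM]; exact (hK.isClosed.preimage continuous_snd).inter (hC.isClosed.preimage hconj)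
  -- the entry bound `θ` on the compact image `π(C × K) ⊆ M_N(ℂ) × {z injective}`
  obtain ⟨θ, hθ⟩ : ∃ θ : Matrix (Fin N) (Fin N) ℂ × (Fin N → ℂ) → ℝ, θ = fun p =>
      ∑ k', ∑ i', ‖w.1.embedding (α i') * (w.1.embedding (α k'))⁻¹ * ∑ m, (Matrix.vandermonde p.2)⁻¹ m i' * (p.1 ^ (m : ℕ)) k' k'‖ :=
    ⟨_, rfl⟩
  have hθc : ContinuousOn θ {p | Function.Injective p.2} := by
    rw [hθ]
    refine continuousOn_finsetSum _ fun k' _ => continuousOn_finsetSum _ fun i' _ => ?_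
    exact (continuousOn_mul_sum_vandermonde_inv_mul_pow_apply (fun i => w.1.embedding (α i)) k' i').norm
  have hπ : Continuous fun q : archLocal L N (Matrix.diagonal α) w × (Fin N → Circle) =>
      ((((q.1 : GL (Fin N) ℂ) : Matrix (Fin N) (Fin N) ℂ)), fun j => (q.2 j : ℂ)) :=
    (Units.continuous_val.comp (continuous_subtype_val.comp continuous_fst)).prodMk
      (continuous_pi fun j => continuous_subtype_val.comp ((continuous_apply j).comp continuous_snd))
  have hCK : IsCompact ((fun q : archLocal L N (Matrix.diagonal α) w × (Fin N → Circle) =>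
      ((((q.1 : GL (Fin N) ℂ) : Matrix (Fin N) (Fin N) ℂ)), fun j => (q.2 j : ℂ))) '' (C ×ˢ K)) := (hC.prod hK).image hπ
  have hCKsub : (fun q : archLocal L N (Matrix.diagonal α) w × (Fin N → Circle) =>
      ((((q.1 : GL (Fin N) ℂ) : Matrix (Fin N) (Fin N) ℂ)), fun j => (q.2 j : ℂ))) '' (C ×ˢ K) ⊆
      {p : Matrix (Fin N) (Fin N) ℂ × (Fin N → ℂ) | Function.Injective p.2} := by
    rintro _ ⟨q, hq, rfl⟩
    exact Subtype.val_injective.comp (hKreg hq.2)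
  obtain ⟨R, hR⟩ := hCK.exists_bound_of_continuousOn (hθc.mono hCKsub)
  -- the box of matrices with entries bounded by `R'`
  obtain ⟨R', hR'⟩ : ∃ R' : ℝ, R' = max (Real.sqrt R) ((∑ j, ‖w.1.embedding (α j)‖⁻¹) * Real.sqrt R * ∑ j, ‖w.1.embedding (α j)‖) :=
    ⟨_, rfl⟩
  have hBox : IsCompact {A : Matrix (Fin N) (Fin N) ℂ | ∀ k i, ‖A k i‖ ≤ R'} := by
    have hb : IsCompact ((Set.univ.pi fun (_ : Fin N) => Set.univ.pi fun (_ : Fin N) => Metric.closedBall (0 : ℂ) R') :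
        Set (Matrix (Fin N) (Fin N) ℂ)) :=
      isCompact_univ_pi fun _ => isCompact_univ_pi fun _ => isCompact_closedBall (0 : ℂ) R'
    have hEq : {A : Matrix (Fin N) (Fin N) ℂ | ∀ k i, ‖A k i‖ ≤ R'} =
        ((Set.univ.pi fun (_ : Fin N) => Set.univ.pi fun (_ : Fin N) => Metric.closedBall (0 : ℂ) R') : Set (Matrix (Fin N) (Fin N) ℂ)) := by
      ext A
      refine ⟨fun h k _ i _ => ?_, fun h k i => ?_⟩
      · simpa only [Metric.mem_closedBall, dist_zero_right] using h k i
      · simpa only [Metric.mem_closedBall, dist_zero_right] using h k (Set.mem_univ k) i (Set.mem_univ i)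
    rw [hEq]
    exact hb
  -- the closed embedding `g ↦ (g, g⁻¹)` of `G_w` into `M_N(ℂ) × M_N(ℂ)`
  have hψ : IsClosedEmbedding fun g : archLocal L N (Matrix.diagonal α) w =>
      ((((g : GL (Fin N) ℂ) : Matrix (Fin N) (Fin N) ℂ)), ((((g : GL (Fin N) ℂ))⁻¹ : GL (Fin N) ℂ) : Matrix (Fin N) (Fin N) ℂ)) := by
    have h1 : IsClosedEmbedding fun g : archLocal L N (Matrix.diagonal α) w => (g : GL (Fin N) ℂ) :=
      (isClosed_archLocal L N (Matrix.diagonal α) w).isClosedEmbedding_subtypeVal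
    have h2 : IsClosedEmbedding (Units.embedProduct (Matrix (Fin N) (Fin N) ℂ)) := Units.isClosedEmbedding_embedProduct
    have h3 := ((Homeomorph.refl (Matrix (Fin N) (Fin N) ℂ)).prodCongr
      (@MulOpposite.opHomeomorph (Matrix (Fin N) (Fin N) ℂ) _).symm).isClosedEmbedding
    exact (h3.comp h2).comp h1
  have hB : IsCompact ((fun g : archLocal L N (Matrix.diagonal α) w =>
      ((((g : GL (Fin N) ℂ) : Matrix (Fin N) (Fin N) ℂ)), ((((g : GL (Fin N) ℂ))⁻¹ : GL (Fin N) ℂ) : Matrix (Fin N) (Fin N) ℂ))) ⁻¹'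
      ({A : Matrix (Fin N) (Fin N) ℂ | ∀ k i, ‖A k i‖ ≤ R'} ×ˢ {A : Matrix (Fin N) (Fin N) ℂ | ∀ k i, ‖A k i‖ ≤ R'})) :=
    hψ.isCompact_preimage (hBox.prod hBox)
  -- `M ⊆ B × K`: the entries of `g` and `g⁻¹` are bounded on `M`
  have hMsub : M ⊆ ((fun g : archLocal L N (Matrix.diagonal α) w =>
      ((((g : GL (Fin N) ℂ) : Matrix (Fin N) (Fin N) ℂ)), ((((g : GL (Fin N) ℂ))⁻¹ : GL (Fin N) ℂ) : Matrix (Fin N) (Fin N) ℂ))) ⁻¹'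
      ({A : Matrix (Fin N) (Fin N) ℂ | ∀ k i, ‖A k i‖ ≤ R'} ×ˢ {A : Matrix (Fin N) (Fin N) ℂ | ∀ k i, ‖A k i‖ ≤ R'})) ×ˢ K := by
    rw [hM]
    rintro ⟨g, z⟩ ⟨hzK, hgC⟩
    have hz : Function.Injective fun j => (z j : ℂ) := Subtype.val_injective.comp (hKreg hzK)
    have hg := coe_mem_unitaryGroupOfForm_diagonal L N α w g
    -- the conjugate, as a matrix, lies in the image set
    have hx : ((((g * ⟨circleDiagonal N z, circleDiagonal_mem_archLocal_diagonal L N α w z⟩ * g⁻¹ :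
        archLocal L N (Matrix.diagonal α) w) : GL (Fin N) ℂ) : Matrix (Fin N) (Fin N) ℂ)) =
        ((g : GL (Fin N) ℂ) : Matrix (Fin N) (Fin N) ℂ) * Matrix.diagonal (fun j => (z j : ℂ)) *
          ((((g : GL (Fin N) ℂ))⁻¹ : GL (Fin N) ℂ) : Matrix (Fin N) (Fin N) ℂ) := by
      rw [Subgroup.coe_mul, Subgroup.coe_mul, Subgroup.coe_inv, Units.val_mul, Units.val_mul]
      rfl
    have hmem := Set.mem_image_of_mem (fun q : archLocal L N (Matrix.diagonal α) w × (Fin N → Circle) =>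
        ((((q.1 : GL (Fin N) ℂ) : Matrix (Fin N) (Fin N) ℂ)), fun j => (q.2 j : ℂ)))
      (Set.mk_mem_prod hgC hzK)
    have h := hR _ hmem
    rw [hθ] at h
    dsimp only at h
    rw [hx, Real.norm_of_nonneg (Finset.sum_nonneg fun _ _ => Finset.sum_nonneg fun _ _ => norm_nonneg _)] at h
    have hsq : ∀ k i, ‖((g : GL (Fin N) ℂ) : Matrix (Fin N) (Fin N) ℂ) k i‖ ^ 2 ≤ R := fun k i =>
      (norm_apply_sq_le_of_mem_unitaryGroupOfForm_diagonal he hg hz k i).trans h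
    have hnorm : ∀ k i, ‖((g : GL (Fin N) ℂ) : Matrix (Fin N) (Fin N) ℂ) k i‖ ≤ Real.sqrt R := fun k i =>
      (le_abs_self _).trans (Real.abs_le_sqrt (hsq k i))
    refine ⟨⟨fun k i => (hnorm k i).trans (by rw [hR']; exact le_max_left _ _), fun i k => ?_⟩, hzK⟩
    rw [norm_coe_inv_apply_of_mem_unitaryGroupOfForm_diagonal he hg, hR']
    refine le_trans ?_ (le_max_right _ _)
    have hci' : ‖w.1.embedding (α i)‖⁻¹ ≤ ∑ j, ‖w.1.embedding (α j)‖⁻¹ :=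
      Finset.single_le_sum (f := fun j => ‖w.1.embedding (α j)‖⁻¹) (fun j _ => inv_nonneg.mpr (norm_nonneg _)) (Finset.mem_univ i)
    have hce' : ‖w.1.embedding (α k)‖ ≤ ∑ j, ‖w.1.embedding (α j)‖ :=
      Finset.single_le_sum (f := fun j => ‖w.1.embedding (α j)‖) (fun j _ => norm_nonneg _) (Finset.mem_univ k)
    gcongr
    exact hnorm k i
  have hMc : IsCompact M := (hB.prod hK).of_isClosed_subset hMclosed hMsub
  -- the set is the first projection of `M`
  have hS : {g : archLocal L N (Matrix.diagonal α) w | ∃ z ∈ K,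
      g * ⟨circleDiagonal N z, circleDiagonal_mem_archLocal_diagonal L N α w z⟩ * g⁻¹ ∈ C} = Prod.fst '' M := by
    rw [hM]
    ext g
    simp only [Set.mem_setOf_eq, Set.mem_image, Prod.exists, exists_and_right, exists_eq_right]
  rw [hS]
  exact hMc.image continuous_fst

/-- **COMPACT SUPPORT OF THE CONJUGATION INTEGRAND AT A REGULAR TORUS POINT**: `g ↦ f(g·diag z·g⁻¹)` has compact support on `G_w` for `f`
compactly supported and `z` regular. [cite: Rogawski1990, §8.3 p. 122] [cite: DeitmarEchterhoff2014, Lemma 9.3.3] -/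
theorem hasCompactSupport_comp_conj_circleDiagonal (hα : ∀ i, α i ≠ 0) {z : Fin N → Circle} (hz : Function.Injective z)
    {E : Type*} [Zero E] (f : archLocal L N (Matrix.diagonal α) w → E) (hfc : HasCompactSupport f) :
    HasCompactSupport fun g : archLocal L N (Matrix.diagonal α) w =>
      f (g * ⟨circleDiagonal N z, circleDiagonal_mem_archLocal_diagonal L N α w z⟩ * g⁻¹) := by
  refine HasCompactSupport.intro (isCompact_setOf_exists_conj_circleDiagonal_mem L N α w hα isCompact_singleton
    (Set.singleton_subset_iff.mpr hz) hfc.isCompact) fun g hg => ?_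
  exact image_eq_zero_of_notMem_tsupport fun h => hg ⟨z, rfl, h⟩

end Proper
/-! ## §3 Continuity of the torus orbital function on the regular set -/

section Continuity

variable (L : Type) [Field L] (N : ℕ) (α : Fin N → L) (w : {w : InfinitePlace L // IsComplex w})
  [MeasurableSpace (archLocal L N (Matrix.diagonal α) w)] [BorelSpace (archLocal L N (Matrix.diagonal α) w)]
  {E : Type*} [NormedAddCommGroup E]

/-- **THE CONJUGATION AVERAGE `z ↦ ∫_{G_w} f(g·diag z·g⁻¹) dν(g)` IS CONTINUOUS ON THE REGULAR SET `T_reg`** — in `G_w` of ANY signature, for `f`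
continuous with compact support and `ν` any measure finite on compact sets (e.g. a Haar measure): on a compact neighbourhood `K ⊆ T_reg` of a regular
point the integrands are supported in ONE compact set (§2), so the parametric integral is continuous (Mathlib `continuousOn_integral_of_compact_support`).
[cite: Rogawski1990, §8.3 p. 122] [cite: Shelstad1979, §4] -/
theorem continuousOn_integral_comp_conj_circleDiagonal [NormedSpace ℝ E] (hα : ∀ i, α i ≠ 0) (ν : Measure (archLocal L N (Matrix.diagonal α) w))
    [IsFiniteMeasureOnCompacts ν] (f : archLocal L N (Matrix.diagonal α) w → E) (hf : Continuous f) (hfc : HasCompactSupport f) :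
    ContinuousOn (fun z : Fin N → Circle =>
      ∫ g, f (g * ⟨circleDiagonal N z, circleDiagonal_mem_archLocal_diagonal L N α w z⟩ * g⁻¹) ∂ν) {z | Function.Injective z} := by
  intro z₀ hz₀
  obtain ⟨K, hKnhds, hKsub, hK⟩ := local_compact_nhds ((isOpen_setOf_injective).mem_nhds hz₀)
  have hS := isCompact_setOf_exists_conj_circleDiagonal_mem L N α w hα hK hKsub hfc.isCompact
  have hcont : ContinuousOn (fun z : Fin N → Circle =>
      ∫ g, f (g * ⟨circleDiagonal N z, circleDiagonal_mem_archLocal_diagonal L N α w z⟩ * g⁻¹) ∂ν) K := by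
    refine continuousOn_integral_of_compact_support hS ?_ ?_
    · refine Continuous.continuousOn ?_
      exact hf.comp ((continuous_snd.mul (((continuous_circleDiagonal N).comp continuous_fst).subtype_mk _)).mul continuous_snd.inv)
    · intro z g hz hg
      exact image_eq_zero_of_notMem_tsupport fun h => hg ⟨z, hz, h⟩
  exact ((continuousWithinAt_iff_continuousAt hKnhds).mp (hcont z₀ (mem_of_mem_nhds hKnhds))).continuousWithinAt

/-- The conjugation integrand at a regular `z` is integrable (continuous with compact support). [cite: Rogawski1990, §8.3 p. 122] -/
theorem integrable_comp_conj_circleDiagonal (hα : ∀ i, α i ≠ 0) (ν : Measure (archLocal L N (Matrix.diagonal α) w))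
    [IsFiniteMeasureOnCompacts ν] {z : Fin N → Circle} (hz : Function.Injective z)
    (f : archLocal L N (Matrix.diagonal α) w → E) (hf : Continuous f) (hfc : HasCompactSupport f) :
    Integrable (fun g : archLocal L N (Matrix.diagonal α) w =>
      f (g * ⟨circleDiagonal N z, circleDiagonal_mem_archLocal_diagonal L N α w z⟩ * g⁻¹)) ν :=
  (hf.comp ((continuous_id.mul continuous_const).mul continuous_id.inv)).integrable_of_hasCompactSupport
    (hasCompactSupport_comp_conj_circleDiagonal L N α w hα hz f hfc)

variable [NormedSpace ℝ E] [LocallyCompactSpace (archLocal L N (Matrix.diagonal α) w)] [SecondCountableTopology (archLocal L N (Matrix.diagonal α) w)]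
  (ν : Measure (archLocal L N (Matrix.diagonal α) w)) [ν.IsHaarMeasure] [ν.IsMulRightInvariant]
  (tT : Measure ((circleDiagonal N).range.subgroupOf (archLocal L N (Matrix.diagonal α) w))) [tT.IsHaarMeasure] [tT.IsInvInvariant]
  [MeasurableSpace (archLocal L N (Matrix.diagonal α) w ⧸ (circleDiagonal N).range.subgroupOf (archLocal L N (Matrix.diagonal α) w))]
  [BorelSpace (archLocal L N (Matrix.diagonal α) w ⧸ (circleDiagonal N).range.subgroupOf (archLocal L N (Matrix.diagonal α) w))]

/-- **THE FIXED-QUOTIENT TORUS TERM `F_f` IS CONTINUOUS ON `T_reg` IN ANY `G_w`** (★ (V2)-Q `integral_descConj_circleDiagonal_eq_inv_smul` writes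
`F_f(z) = t_T(T_w)⁻¹ • ∫ f(g·diag z·g⁻¹) dν` at every `z`; the previous theorem).  At a regular `z` this IS the Weil-form orbital integral
`O_{diag z}(f; dν∕dρ_z)` by ★ `orbitalIntegral_circleDiagonal_eq_inv_smul`, so «`Φ(γ, f)` is continuous on `T_reg`» (the (L-cont) input) reads off by name.
[cite: Rogawski1990, §8.3 p. 122; §4.9 p. 54] [cite: Shelstad1979, §4] -/
theorem continuousOn_integral_descConj_circleDiagonal_of_hasCompactSupport (hα : ∀ i, α i ≠ 0)
    (f : archLocal L N (Matrix.diagonal α) w → E) (hf : Continuous f) (hfc : HasCompactSupport f) :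
    ContinuousOn (fun z : Fin N → Circle =>
      ∫ y, descConj (⟨circleDiagonal N z, circleDiagonal_mem_archLocal_diagonal L N α w z⟩ : archLocal L N (Matrix.diagonal α) w)
        ((circleDiagonal N).range.subgroupOf (archLocal L N (Matrix.diagonal α) w)) (circleTorus_comm_circleDiagonal L N α w z) f y
        ∂(quotientMeasure _ tT (isClosed_circleTorus L N α w) ν)) {z | Function.Injective z} := by
  have h : (fun z : Fin N → Circle =>
      ∫ y, descConj (⟨circleDiagonal N z, circleDiagonal_mem_archLocal_diagonal L N α w z⟩ : archLocal L N (Matrix.diagonal α) w)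
        ((circleDiagonal N).range.subgroupOf (archLocal L N (Matrix.diagonal α) w)) (circleTorus_comm_circleDiagonal L N α w z) f y
        ∂(quotientMeasure _ tT (isClosed_circleTorus L N α w) ν)) =
      fun z => (tT.real Set.univ)⁻¹ • ∫ g, f (g * ⟨circleDiagonal N z, circleDiagonal_mem_archLocal_diagonal L N α w z⟩ * g⁻¹) ∂ν :=
    funext fun z => integral_descConj_circleDiagonal_eq_inv_smul L N α w ν tT z f hf
  rw [h]
  exact (continuousOn_integral_comp_conj_circleDiagonal L N α w hα ν f hf hfc).const_smul _

end Continuity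

end Literature.NumberTheory.Automorphic.UnitaryGroup

end
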